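import Summits.BirchSwinnertonDyer.Rank1Residual.GreenbergMuConjecture
import Summits.BirchSwinnertonDyer.BirchSwinnertonDyer.Theorems.EisensteinPrimesMazurMCOnX1RankZeroGreenbergMuShape
import Literature.NumberTheory.EllipticCurves.SkinnerUrban2014.PAdicUnitPeriodRatioProofs
import Literature.NumberTheory.EllipticCurves.IwasawaOrderOfVanishingProofs
import HarnessLib
import HarnessLib.Audit

/-!
# Kernel edges of the conjecture leaf `GreenbergMuConjecture` (LNM 1716, Conj. 1.11) — PROVED
# bookkeeping, nothing asserted (typing layer D-0088(4), cell `bsd-littype`, seat 11, gen 4)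

The sibling `GreenbergMuConjecture.lean` is a PURE conjecture leaf (two `@[conjecture]` defs:
`GreenbergMuConjecture` = the printed isogeny form, `GreenbergMuConjectureIrreducible` = the printed
"In particular" clause). This file proves the kernel edges that make the leaf usable BY NAME:

* §1 `irreducible_of_isogenyForm` — **isogeny form ⇒ "in particular" irreducible form**, exactly
  Greenberg's own one-line derivation (p. 58: "the above conjecture effectively predicts the value of
  `μ_E`"): if `E[p]` is irreducible, the `ℚ`-isogenous curve `E′` with `μ_{E′} = 0` is reached from
  `E` by an isogeny of degree PRIME TO `p` (tree theorem
  `SkinnerUrban2014.exists_isogeny_not_dvd_degree_of_irreducible`: descent on the degree, an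
  isogeny of degree divisible by `p` factors through `[p]` because `E[p] ⊆ ker`), cotorsion passes
  to `E′` (`SelmerDualData.isTorsion_and_charIdeal_mul_span_eq_of_isIsogenous`), and the algebraic
  `μ` is invariant under prime-to-`p` isogenies (bsd-eis kernel
  `EisensteinPrimesMazurMCOnX1RankZeroMuEtaleEnd.mu_eq_of_isogeny_not_dvd_degree`, p471995: the
  `Λ`-linear duals of `Sel(φ)`, `Sel(φ̂)` compose to the unit `deg φ`). No Schneider / Perrin-Riou
  isogeny formula is needed for this direction. Pointwise form `mu_eq_zero_of_isogenyFormAt`.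
* §2 `x9Shape_of_irreducibleForm` — the irreducible form feeds the per-pair binder
  `hμ : ∀ κ γ, κ.IsCyclotomic → κ.IsTopGenerator γ → IsCyclotomicVariable p γ → ∀ D, D.mu = 0` of the
  X9 conditional kernels (`Literature/…/Rank1Residual/X9MuInvariant.lean`:
  `mazurMainConjecture_neron_of_mu_eq_zero`, `X9.bsdp_of_mu_eq_zero…`), the torsion guard of the
  leaf being discharged at a good ordinary `p ≠ 2` by Kato–Rohrlich cotorsion
  (`SelmerDualData.isTorsion_of_kato_divisibility`, from the registered Kato divisibility binder).
* §3 `stub_analyticMuZero_offLocus_of_greenbergMuConjecture_of_muPart` — the one-line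
  instantiation `hG := ‹GreenbergMuConjecture›` of the bsd-eis kernel
  `EisensteinPrimesMazurMCOnX1RankZeroGreenbergMuShape.stub_of_greenbergMuShape_of_muPart`
  (p473343; crux `MazurMCOnX1RankZero` = stmt-BirchSwinnertonDyer-19035, line `mudescent`, stub
  `stub_analyticMuZero_offLocus`): the stub's registered signature follows from the LEAF + the
  `μ`-part of Mazur's main conjecture at the off-locus rank-`0` X1 members (M) + Prop. 5.7 + Wuthrich
  Thm. 16 + modularity; and `greenbergMu_located_of_greenbergMuConjecture` (the located form (G_loc)).
  CLOSES NOTHING: the leaf is OPEN; this is the conditional closure recorded by bsd-eis mu-b MEMO-2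
  («when the leaf lands, stub 4 of mudescent closes CONDITIONALLY on it + (M)»), now by name.

HONEST FRAMING (cell, verbatim): "no tranche here proves BSD; … typed ≠ proved ≠ endorsed".
Theorems only; every hypothesis displayed; no Literature fact introduced. References:
[GreenbergLNM1716] Conj. 1.11 (p. 58), Thm. 1.5 (p. 61), Prop. 5.7 (p. 113); [GreenbergVatsal2000]
§2 p. 28, §3 Rem. 3.4; [Kato2004Asterisque] Thm. 17.4; [Wuthrich2014] Thm. 16. HOME
`run/shared/lean/pub/bsd-littype/` (OPEN-QUESTIONS-11 Q-N1/Q-N2), `run/shared/lean/pub/bsd-eis/mu-b-MEMO-2.md`.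
-/

set_option autoImplicit false

noncomputable section

open scoped Classical

open WeierstrassCurve Field
  Literature.NumberTheory.EllipticCurves Literature.NumberTheory.EllipticCurves.Rank1Residual
  Literature.NumberTheory.EllipticCurves.ModularForms
  Literature.NumberTheory.EllipticCurves.Greenberg1999
  Literature.Barriers.BirchSwinnertonDyer
  Summit.BirchSwinnertonDyer.Rank1Residual
  Summit.BirchSwinnertonDyer.BirchSwinnertonDyer.Theorems
  Summit.BirchSwinnertonDyer.BirchSwinnertonDyer.Theorems.EisensteinPrimesMazurMCOnX1RankZeroMuEtaleEnd
  Summit.BirchSwinnertonDyer.BirchSwinnertonDyer.Theorems.EisensteinPrimesMazurMCOnX1RankZeroGreenbergMuShape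

namespace Summit.BirchSwinnertonDyer.Rank1Residual.GreenbergMu

/-! ## §1. Isogeny form ⇒ irreducible form (Greenberg's "In particular") -/

/-- **Pointwise: the isogeny form of Conj. 1.11 at `(E, p, κ, γ, D)` gives `μ_E = 0` when `E[p]` is
irreducible.** If some `ℚ`-isogenous elliptic `W′` has `μ = 0` for all its torsion dual data over
`(κ, γ)`, `E[p]` is irreducible and `D` is torsion, then `D.mu = 0`: choose an isogeny `ψ : W → W′`
of degree prime to `p` (`exists_isogeny_not_dvd_degree_of_irreducible`), the datum
`D′ = X(E′/ℚ_∞)` (`selmerDualData`) is torsion (`isTorsion_and_charIdeal_mul_span_eq_of_isIsogenous`)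
so `μ(D′) = 0`, and `μ(D′) = μ(D)` (`mu_eq_of_isogeny_not_dvd_degree`).
[cite: GreenbergLNM1716, §1 Conj. 1.11 and the isogeny paragraph (p. 58)] [cite: GreenbergVatsal2000, §3 Rem. 3.4] -/
theorem mu_eq_zero_of_isogenyFormAt (W : WeierstrassCurve ℚ) [W.IsElliptic] (p : ℕ) [Fact p.Prime]
    {κ : ZpExtension ℚ p} {γ : Field.absoluteGaloisGroup ℚ} (hγ : κ.IsTopGenerator γ)
    (hirr : W.HasIrreducibleModPGaloisRep p) (D : W.SelmerDualData κ γ) (hD : D.IsTorsion)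
    (hG : ∃ (W' : WeierstrassCurve ℚ) (_ : W'.IsElliptic), W.IsIsogenous W' ∧
      ∀ D' : W'.SelmerDualData κ γ, D'.IsTorsion → D'.mu = 0) :
    D.mu = 0 := by
  obtain ⟨W', hE', hiso, hμ'⟩ := hG
  haveI := hE'
  have hp0 : ((p : ℕ) : ℚ) ≠ 0 := by exact_mod_cast (Fact.out : p.Prime).ne_zero
  obtain ⟨ψ, hψ⟩ := SkinnerUrban2014.exists_isogeny_not_dvd_degree_of_irreducible hp0 hirr hiso
  let D' : W'.SelmerDualData κ γ := W'.selmerDualData κ hγ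
  have hD' : D'.IsTorsion := (D.isTorsion_and_charIdeal_mul_span_eq_of_isIsogenous D' hiso hγ hD).1
  rw [← mu_eq_of_isogeny_not_dvd_degree ψ hψ D D']
  exact hμ' D' hD'

/-- **Greenberg's Conj. 1.11: the isogeny form implies the "In particular" (irreducible) form** —
the printed derivation, kernel-checked: `GreenbergMuConjecture → GreenbergMuConjectureIrreducible`.
[cite: GreenbergLNM1716, §1 Conj. 1.11 (p. 58)] -/
theorem irreducible_of_isogenyForm (h : GreenbergMuConjecture) : GreenbergMuConjectureIrreducible := by
  intro W _ p _ κ γ hκ hγ hirr D hD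
  exact mu_eq_zero_of_isogenyFormAt W p hγ hirr D hD (h W p κ γ hκ hγ D hD)

/-! ## §2. The irreducible form feeds the X9 per-pair binder `hμ` -/

/-- **The leaf's irreducible form gives the X9 kernels' binder `hμ` at a good ordinary `p ≠ 2` with
`E[p]` irreducible**, the leaf's torsion guard being Kato–Rohrlich cotorsion
(`SelmerDualData.isTorsion_of_kato_divisibility`, fed by the registered Kato divisibility binder for
a newform `f` of `E`). The conclusion is literally the hypothesis `hμ` of
`Rank1Residual.mazurMainConjecture_neron_of_mu_eq_zero` / `X9.bsdp_of_mu_eq_zero…`.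
[cite: GreenbergLNM1716, §1 Conj. 1.11 (p. 58) and Thm. 1.5 (p. 61)] [cite: Kato2004Asterisque, Thm. 17.4 (p. 273)] -/
theorem x9Shape_of_irreducibleForm (h : GreenbergMuConjectureIrreducible)
    (W : WeierstrassCurve ℚ) [W.IsElliptic] [W.IsGloballyMinimal] (p : ℕ) [Fact p.Prime]
    {N : ℕ} [NeZero N] {f : CuspForm (CongruenceSubgroup.Gamma0 N) 2} (hf : IsNewformOf W f)
    (hp : p ≠ 2) (hord : IsOrdinaryAt W p)
    (hkato : ∀ (κ : ZpExtension ℚ p) (γ : Field.absoluteGaloisGroup ℚ),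
      kato_divisibility W p (κ := κ) (γ := γ) (f := f))
    (hirr : W.HasIrreducibleModPGaloisRep p) :
    ∀ (κ : ZpExtension ℚ p) (γ : Field.absoluteGaloisGroup ℚ),
        κ.IsCyclotomic → κ.IsTopGenerator γ → IsCyclotomicVariable p γ →
      ∀ (D : W.SelmerDualData κ γ), D.mu = 0 :=
  fun κ γ hκ hγ _ D ↦ h W p κ γ hκ hγ hirr D
    (SelmerDualData.isTorsion_of_kato_divisibility W p hf hp hord hkato hκ D)

/-- The same from the ISOGENY form (`irreducible_of_isogenyForm`).
[cite: GreenbergLNM1716, §1 Conj. 1.11 (p. 58)] [cite: Kato2004Asterisque, Thm. 17.4 (p. 273)] -/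
theorem x9Shape_of_isogenyForm (h : GreenbergMuConjecture)
    (W : WeierstrassCurve ℚ) [W.IsElliptic] [W.IsGloballyMinimal] (p : ℕ) [Fact p.Prime]
    {N : ℕ} [NeZero N] {f : CuspForm (CongruenceSubgroup.Gamma0 N) 2} (hf : IsNewformOf W f)
    (hp : p ≠ 2) (hord : IsOrdinaryAt W p)
    (hkato : ∀ (κ : ZpExtension ℚ p) (γ : Field.absoluteGaloisGroup ℚ),
      kato_divisibility W p (κ := κ) (γ := γ) (f := f))
    (hirr : W.HasIrreducibleModPGaloisRep p) :
    ∀ (κ : ZpExtension ℚ p) (γ : Field.absoluteGaloisGroup ℚ),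
        κ.IsCyclotomic → κ.IsTopGenerator γ → IsCyclotomicVariable p γ →
      ∀ (D : W.SelmerDualData κ γ), D.mu = 0 :=
  x9Shape_of_irreducibleForm (irreducible_of_isogenyForm h) W p hf hp hord hkato hirr

/-! ## §3. The bsd-eis stub `stub_analyticMuZero_offLocus` from the leaf + (M) -/

/-- **The located form (G_loc) on the rank-`0` X1 classes from the leaf** (granted Prop. 5.7, Wuthrich
Thm. 16, modularity): instantiation of the bsd-eis kernel
`greenbergMu_located_of_greenbergMuShape` (p473343) with `hG := ‹GreenbergMuConjecture›`.
[cite: GreenbergLNM1716, Conj. 1.11 (p. 58) and Prop. 5.7 (p. 113)] [cite: Wuthrich2014, Thm. 16 (p. 397)] -/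
theorem greenbergMu_located_of_greenbergMuConjecture
    (h57 : prop57_one_le_mu_of_ramified_odd_line) (hW16 : Wuthrich2014.charIdeal_dvd_padicLFunction)
    (hmod : nonempty_modularParametrizationData) (hG : GreenbergMuConjecture) :
    ∀ (W₀ : WeierstrassCurve ℚ) [W₀.IsElliptic] [W₀.IsGloballyMinimal] (p : ℕ) [Fact p.Prime],
      ClassX1 W₀ p → W₀.analyticRank = 0 → ¬ HasRamifiedOddLineAt W₀ p →
      ∀ (κ : ZpExtension ℚ p) (γ : Field.absoluteGaloisGroup ℚ),
        κ.IsCyclotomic → κ.IsTopGenerator γ → IsCyclotomicVariable p γ →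
        ∀ D : W₀.SelmerDualData κ γ, D.mu = 0 :=
  greenbergMu_located_of_greenbergMuShape h57 hW16 hmod hG

/-- **Stub 4 of line `mudescent` (crux `MazurMCOnX1RankZero`, stmt-BirchSwinnertonDyer-19035) from
the LEAF + (M)** — instantiation of `stub_of_greenbergMuShape_of_muPart` (bsd-eis mu-b, p473343) with
`hG := ‹GreenbergMuConjecture›`: granted Prop. 5.7 (`h57`), Wuthrich Thm. 16 (`hW16`), modularity
(`hmod`) and the `μ`-part of Mazur's main conjecture at the off-locus rank-`0` X1 members (`hM`),
Greenberg's Conj. 1.11 yields the registered signature of `stub_analyticMuZero_offLocus` verbatim.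
Conditional closure only: the leaf is OPEN; nothing is asserted.
[cite: GreenbergLNM1716, Conj. 1.11 (p. 58) and Prop. 5.7 (p. 113)] [cite: Wuthrich2014, Thm. 16 (p. 397)] -/
theorem stub_analyticMuZero_offLocus_of_greenbergMuConjecture_of_muPart
    (h57 : prop57_one_le_mu_of_ramified_odd_line) (hW16 : Wuthrich2014.charIdeal_dvd_padicLFunction)
    (hmod : nonempty_modularParametrizationData)
    (hM : ∀ (W₀ : WeierstrassCurve ℚ) [W₀.IsElliptic] [W₀.IsGloballyMinimal] (p : ℕ) [Fact p.Prime],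
      ClassX1 W₀ p → W₀.analyticRank = 0 → ¬ HasRamifiedOddLineAt W₀ p → X1.MuLambda.MuPartAt W₀ p)
    (hG : GreenbergMuConjecture) :
    ∀ (W₀ : WeierstrassCurve ℚ) [W₀.IsElliptic] [W₀.IsGloballyMinimal] (p : ℕ) [Fact p.Prime],
      ClassX1 W₀ p → W₀.analyticRank = 0 → ¬ HasRamifiedOddLineAt W₀ p →
        X1.MuPart.AnalyticMuLE W₀ p 0 :=
  stub_of_greenbergMuShape_of_muPart h57 hW16 hmod hM hG

end Summit.BirchSwinnertonDyer.Rank1Residual.GreenbergMu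

end
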